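import Literature.Probability.LatticeModels.PointwiseScalingLimitEtaExists
import Summits.CriticalPhenomena.Ising3DConformalLimit.Theorems.SubPtolemyInterlacingInterlacingForcesU4
import HarnessLib

/-!
# Stub S1 `stub_floorOfSusceptibilityFloor` of line `Sketch` for crux `SubPtolemyFloor`
# (item stmt-CriticalPhenomena-15703, route `SubPtolemyInterlacing`)

THEOREM-ONLY file (no definitions, no named facts). It proves, unconditionally, the transfer
"integrated floor ⇒ axial floor" for the critical two-point function
`G = criticalTwoPoint 3` of the nearest-neighbour Ising model on `ℤ³`:

if `1 ≤ a₀ < 3` and `χ_n := Σ_{x ∈ Λ_n} G(x) ≥ c n^{3-a₀}` for all `n ≥ 1` (`Λ_n = box 3 n`), then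
`G(m e₁) ≥ c' m^{-2a₀/(3-a₀)}` for all `m ≥ 1`.

Proof (pattern of the infrared-subtraction step of Simon 1980, with Messager–Miracle-Solé
monotonicity):

* (shells) the infrared bound `G(x) ≤ C ‖x‖_∞^{-1}` (`criticalTwoPoint_bounds_holds`) summed over
  the spheres `∂Λ_r`, `|∂Λ_{k+1}| ≤ 6 (2k+3)²` (`card_sphere_succ_le`), gives
  `Σ_{x ∈ Λ_k} G(x) ≤ 1 + 54 max(C,0) k²` (`floorOfSusceptibilityFloor_sum_box_le_quadratic`);
* (two scales) for `n, m ≥ 1`, splitting `Λ_n` at `‖x‖_∞ ≤ m` and using the MMS bound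
  `G(x) ≤ G(‖x‖_∞ e₁) ≤ G(m e₁)` for `‖x‖_∞ > m` (`criticalTwoPoint_axis_sandwich`,
  `criticalTwoPoint_axis_antitone`) and `|Λ_n| = (2n+1)³ ≤ 27 n³`:
  `χ_n ≤ A m² + 27 n³ G(m e₁)` (`floorOfSusceptibilityFloor_sum_box_le_twoScale`);
* (choice of scales) with `n = ⌈(2A/c)^{1/(3-a₀)} m^{2/(3-a₀)}⌉₊` one has `A m² ≤ (c/2) n^{3-a₀}`,
  hence `G(m e₁) ≥ (c/54) n^{-a₀} ≥ c' m^{-2a₀/(3-a₀)}`.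

Sources: B. Simon, Comm. Math. Phys. 77 (1980) 111 (Theorem 1, pattern); A. Messager,
S. Miracle-Solé, J. Stat. Phys. 17 (1977) 245; H. Duminil-Copin, Lectures on the Ising and Potts
models (2019), §4.3–4.4. Every input is a theorem of the tree; the axis-site identity
`(m:ℤ) • e₁ = Pi.single 0 m` is reused from `interlacingForcesU4_axSite_eq`.
-/

noncomputable section

namespace Summit.CriticalPhenomena.Ising3DConformalLimit.SubPtolemyFloorSketch

open scoped BigOperators Classical
open Finset Literature.Probability.LatticeModels

/-- **Shell summation of the infrared bound**: there is `B ≥ 0` with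
`Σ_{x ∈ Λ_k} ⟨σ₀σ_x⟩_{β_c} ≤ 1 + B k²` for every `k` (from `G(x) ≤ C‖x‖_∞^{-1}` on `ℤ³` and
`|∂Λ_{k+1}| ≤ 6(2k+3)²`). [folklore] -/
theorem floorOfSusceptibilityFloor_sum_box_le_quadratic :
    ∃ B : ℝ, 0 ≤ B ∧ ∀ k : ℕ, ∑ x ∈ box 3 k, criticalTwoPoint 3 x ≤ 1 + B * (k : ℝ) ^ 2 := by
  obtain ⟨c, C, -, hbd⟩ := criticalTwoPoint_bounds_holds (d := 3) le_rfl
  refine ⟨54 * max C 0, by positivity, fun k => ?_⟩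
  have hC : 0 ≤ max C 0 := le_max_right C 0
  induction k with
  | zero =>
    have hbox0 : box 3 0 = {0} := by
      ext x
      rw [mem_box_iff_supNorm_le, Finset.mem_singleton, Nat.le_zero, Site.supNorm_eq_zero_iff]
    rw [hbox0, Finset.sum_singleton, criticalTwoPoint_zero']
    norm_num
  | succ k ih =>
    have hsub : box 3 k ⊆ box 3 (k + 1) := box_mono 3 (Nat.le_succ k)
    rw [← Finset.sum_sdiff hsub, ← sphere_succ_eq_sdiff]
    have hk1 : (0 : ℝ) < (k : ℝ) + 1 := by positivity
    -- pointwise infrared bound on the shell `∂Λ_{k+1}`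
    have hpt : ∀ x ∈ sphere 3 (k + 1), criticalTwoPoint 3 x ≤ max C 0 * ((k : ℝ) + 1)⁻¹ := by
      intro x hx
      have hxn : Site.supNorm x = k + 1 := mem_sphere.1 hx
      have hx0 : x ≠ 0 := by
        intro h0
        rw [h0, Site.supNorm_eq_zero_iff.2 rfl] at hxn
        omega
      have hup := (hbd x hx0).2
      have hnorm : (‖x‖ : ℝ) = (k : ℝ) + 1 := by
        rw [Site.norm_eq_supNorm, hxn]
        push_cast
        ring
      have hexp : (‖x‖ : ℝ) ^ (-(((3 : ℕ) : ℝ) - 2)) = ((k : ℝ) + 1)⁻¹ := by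
        rw [hnorm, show (-(((3 : ℕ) : ℝ) - 2)) = (-1 : ℝ) by norm_num, Real.rpow_neg_one]
      rw [hexp] at hup
      exact hup.trans (mul_le_mul_of_nonneg_right (le_max_left C 0) (inv_nonneg.2 hk1.le))
    have hcard : (#(sphere 3 (k + 1)) : ℝ) ≤ 6 * (2 * k + 3 : ℝ) ^ 2 := by
      have h := card_sphere_succ_le (d := 3) k
      norm_num at h
      linarith
    have hshell : ∑ x ∈ sphere 3 (k + 1), criticalTwoPoint 3 x ≤ 54 * max C 0 * ((k : ℝ) + 1) := by
      calc ∑ x ∈ sphere 3 (k + 1), criticalTwoPoint 3 x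
          ≤ ∑ x ∈ sphere 3 (k + 1), max C 0 * ((k : ℝ) + 1)⁻¹ := Finset.sum_le_sum hpt
        _ = (#(sphere 3 (k + 1)) : ℝ) * (max C 0 * ((k : ℝ) + 1)⁻¹) := by
            rw [Finset.sum_const, nsmul_eq_mul]
        _ ≤ 6 * (2 * k + 3 : ℝ) ^ 2 * (max C 0 * ((k : ℝ) + 1)⁻¹) :=
            mul_le_mul_of_nonneg_right hcard (mul_nonneg hC (inv_nonneg.2 hk1.le))
        _ = 6 * max C 0 * ((2 * k + 3 : ℝ) ^ 2 / ((k : ℝ) + 1)) := by ring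
        _ ≤ 6 * max C 0 * (9 * ((k : ℝ) + 1)) := by
            have hle : (2 * k + 3 : ℝ) ^ 2 / ((k : ℝ) + 1) ≤ 9 * ((k : ℝ) + 1) := by
              rw [div_le_iff₀ hk1]
              have hk0 : (0 : ℝ) ≤ k := Nat.cast_nonneg k
              nlinarith
            exact mul_le_mul_of_nonneg_left hle (by positivity)
        _ = 54 * max C 0 * ((k : ℝ) + 1) := by ring
    have hCk : 0 ≤ max C 0 * (k : ℝ) := mul_nonneg hC (Nat.cast_nonneg k)
    push_cast
    nlinarith [hshell, ih, hCk]

/-- **Two-scale bound** (MMS + infrared): there is `A > 0` with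
`χ_n = Σ_{x ∈ Λ_n} ⟨σ₀σ_x⟩_{β_c} ≤ A m² + 27 n³ ⟨σ₀σ_{m e₁}⟩_{β_c}` for all `n, m ≥ 1`: the sites
with `‖x‖_∞ ≤ m` contribute at most `Σ_{Λ_m} G ≤ A m²`, the others at most `|Λ_n| G(m e₁)` by
`G(x) ≤ G(‖x‖_∞ e₁) ≤ G(m e₁)` (Messager–Miracle-Solé). [folklore] -/
theorem floorOfSusceptibilityFloor_sum_box_le_twoScale :
    ∃ A : ℝ, 0 < A ∧ ∀ n m : ℕ, 1 ≤ n → 1 ≤ m →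
      ∑ x ∈ box 3 n, criticalTwoPoint 3 x ≤
        A * (m : ℝ) ^ 2 + 27 * (n : ℝ) ^ 3 * criticalTwoPoint 3 (Pi.single 0 (m : ℤ)) := by
  obtain ⟨B, hB, hbox⟩ := floorOfSusceptibilityFloor_sum_box_le_quadratic
  refine ⟨1 + B, by positivity, fun n m hn hm => ?_⟩
  have hg0 : 0 ≤ criticalTwoPoint 3 (Pi.single 0 (m : ℤ)) := criticalTwoPoint_nonneg' _
  have hm' : (1 : ℝ) ≤ m := by exact_mod_cast hm
  have hn' : (1 : ℝ) ≤ n := by exact_mod_cast hn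
  rw [← Finset.sum_filter_add_sum_filter_not (box 3 n) (fun x => Site.supNorm x ≤ m)]
  have h1 : ∑ x ∈ (box 3 n).filter (fun x => Site.supNorm x ≤ m), criticalTwoPoint 3 x ≤
      (1 + B) * (m : ℝ) ^ 2 := by
    calc ∑ x ∈ (box 3 n).filter (fun x => Site.supNorm x ≤ m), criticalTwoPoint 3 x
        ≤ ∑ x ∈ box 3 m, criticalTwoPoint 3 x := by
          refine Finset.sum_le_sum_of_subset_of_nonneg (fun x hx => ?_)
            (fun x _ _ => criticalTwoPoint_nonneg' x)
          rw [Finset.mem_filter] at hx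
          exact mem_box_iff_supNorm_le.2 hx.2
      _ ≤ 1 + B * (m : ℝ) ^ 2 := hbox m
      _ ≤ (1 + B) * (m : ℝ) ^ 2 := by nlinarith
  have h2 : ∑ x ∈ (box 3 n).filter (fun x => ¬ Site.supNorm x ≤ m), criticalTwoPoint 3 x ≤
      27 * (n : ℝ) ^ 3 * criticalTwoPoint 3 (Pi.single 0 (m : ℤ)) := by
    calc ∑ x ∈ (box 3 n).filter (fun x => ¬ Site.supNorm x ≤ m), criticalTwoPoint 3 x
        ≤ ∑ x ∈ (box 3 n).filter (fun x => ¬ Site.supNorm x ≤ m),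
            criticalTwoPoint 3 (Pi.single 0 (m : ℤ)) := by
          refine Finset.sum_le_sum fun x hx => ?_
          rw [Finset.mem_filter, not_le] at hx
          have hx1 : 1 ≤ Site.supNorm x := le_trans hm hx.2.le
          exact (criticalTwoPoint_axis_sandwich hx1).2.trans
            (criticalTwoPoint_axis_antitone hx.2.le)
      _ = (#((box 3 n).filter (fun x => ¬ Site.supNorm x ≤ m)) : ℝ) *
            criticalTwoPoint 3 (Pi.single 0 (m : ℤ)) := by
          rw [Finset.sum_const, nsmul_eq_mul]
      _ ≤ (#(box 3 n) : ℝ) * criticalTwoPoint 3 (Pi.single 0 (m : ℤ)) := by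
          refine mul_le_mul_of_nonneg_right ?_ hg0
          exact_mod_cast Finset.card_le_card (Finset.filter_subset _ _)
      _ ≤ 27 * (n : ℝ) ^ 3 * criticalTwoPoint 3 (Pi.single 0 (m : ℤ)) := by
          refine mul_le_mul_of_nonneg_right ?_ hg0
          rw [card_box]
          push_cast
          have hle : (2 * (n : ℝ) + 1) ≤ 3 * n := by linarith
          calc (2 * (n : ℝ) + 1) ^ 3 ≤ (3 * (n : ℝ)) ^ 3 := pow_le_pow_left₀ (by positivity) hle 3
            _ = 27 * (n : ℝ) ^ 3 := by ring
  linarith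

/-- **S1 — unconditional transfer (integrated floor ⇒ axial floor, exponent `2a₀/(3-a₀)`).**
For the critical two-point function `G = ⟨σ₀σ_x⟩_{β_c}` of the nearest-neighbour Ising model on
`ℤ³`: if `1 ≤ a₀ < 3` and `Σ_{x ∈ Λ_n} G(x) ≥ c n^{3-a₀}` for all `n ≥ 1`, then
`G(m e₁) ≥ c' m^{-2a₀/(3-a₀)}` for all `m ≥ 1`. Route: the two-scale bound
`χ_n ≤ A m² + 27 n³ G(m e₁)` (infrared bound summed over shells + Messager–Miracle-Solé) at
`n = ⌈(2A/c)^{1/(3-a₀)} m^{2/(3-a₀)}⌉₊`, where `A m² ≤ (c/2) n^{3-a₀}`. [folklore] -/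
theorem stub_floorOfSusceptibilityFloor :
    ∀ a₀ : ℝ, 1 ≤ a₀ → a₀ < 3 →
      (∃ c : ℝ, 0 < c ∧ ∀ n : ℕ, 1 ≤ n →
        c * (n : ℝ) ^ (3 - a₀) ≤ ∑ x ∈ box 3 n, criticalTwoPoint 3 x) →
      ∃ c : ℝ, 0 < c ∧ ∀ n : ℕ, 1 ≤ n →
        c * (n : ℝ) ^ (-(2 * a₀ / (3 - a₀))) ≤ criticalTwoPoint 3 ((n : ℤ) • (Pi.single 0 1 : Site 3)) := by
  intro a₀ h1 h3 hχ
  obtain ⟨c, hc, hχ⟩ := hχ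
  obtain ⟨A, hA, hAB⟩ := floorOfSusceptibilityFloor_sum_box_le_twoScale
  have hs0 : 0 < 3 - a₀ := sub_pos.2 h3
  have ha0 : 0 ≤ a₀ := le_trans zero_le_one h1
  -- the constant `K = (2A/c)^{1/(3-a₀)}` and the exponent `e = 2/(3-a₀)`
  obtain ⟨K, hK⟩ : ∃ K : ℝ, K = (2 * A / c) ^ (3 - a₀)⁻¹ := ⟨_, rfl⟩
  have hK0 : 0 < K := by rw [hK]; exact Real.rpow_pos_of_pos (by positivity) _
  have hK1 : 0 < K + 1 := by linarith
  refine ⟨c / 54 * (K + 1) ^ (-a₀), mul_pos (by positivity) (Real.rpow_pos_of_pos hK1 _),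
    fun m hm => ?_⟩
  rw [Summit.CriticalPhenomena.Ising3DConformalLimit.Theorems.interlacingForcesU4_axSite_eq]
  have hm' : (1 : ℝ) ≤ m := by exact_mod_cast hm
  have hm0 : (0 : ℝ) < m := by positivity
  obtain ⟨e, he⟩ : ∃ e : ℝ, e = 2 / (3 - a₀) := ⟨_, rfl⟩
  have he0 : 0 ≤ e := by rw [he]; positivity
  -- the scale `n = ⌈K m^e⌉₊`
  obtain ⟨X, hX⟩ : ∃ X : ℝ, X = K * (m : ℝ) ^ e := ⟨_, rfl⟩
  have hX0 : 0 < X := by rw [hX]; exact mul_pos hK0 (Real.rpow_pos_of_pos hm0 _)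
  obtain ⟨n, hn⟩ : ∃ n : ℕ, n = ⌈X⌉₊ := ⟨_, rfl⟩
  have hn1 : 1 ≤ n := by
    rw [hn]
    exact Nat.one_le_iff_ne_zero.2 (Nat.ceil_pos.2 hX0).ne'
  have hnX : X ≤ n := by rw [hn]; exact Nat.le_ceil X
  have hn0 : (0 : ℝ) < n := hX0.trans_le hnX
  have hnup : (n : ℝ) ≤ (K + 1) * (m : ℝ) ^ e := by
    have hlt : (n : ℝ) < X + 1 := by rw [hn]; exact Nat.ceil_lt_add_one hX0.le
    have hme : (1 : ℝ) ≤ (m : ℝ) ^ e := Real.one_le_rpow hm' he0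
    rw [add_mul, one_mul, ← hX]
    linarith
  -- `X^{3-a₀} = (2A/c) m²`, hence `A m² ≤ (c/2) n^{3-a₀}`
  have hXs : X ^ (3 - a₀) = 2 * A / c * (m : ℝ) ^ 2 := by
    rw [hX, Real.mul_rpow hK0.le (Real.rpow_nonneg hm0.le _), hK,
      Real.rpow_inv_rpow (by positivity) hs0.ne', ← Real.rpow_mul hm0.le, he,
      div_mul_cancel₀ _ hs0.ne', Real.rpow_two]
  have hns : 2 * A / c * (m : ℝ) ^ 2 ≤ (n : ℝ) ^ (3 - a₀) := by
    rw [← hXs]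
    exact Real.rpow_le_rpow hX0.le hnX hs0.le
  have hAm : A * (m : ℝ) ^ 2 ≤ c / 2 * (n : ℝ) ^ (3 - a₀) := by
    have h := mul_le_mul_of_nonneg_left hns (by positivity : (0 : ℝ) ≤ c / 2)
    calc A * (m : ℝ) ^ 2 = c / 2 * (2 * A / c * (m : ℝ) ^ 2) := by field_simp
      _ ≤ c / 2 * (n : ℝ) ^ (3 - a₀) := h
  -- the main chain `c n^{3-a₀} ≤ χ_n ≤ A m² + 27 n³ g(m)`
  have hmain := (hχ n hn1).trans (hAB n m hn1 hm)
  have hkey : c / 2 * (n : ℝ) ^ (3 - a₀) ≤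
      27 * (n : ℝ) ^ 3 * criticalTwoPoint 3 (Pi.single 0 (m : ℤ)) := by linarith
  -- `n^{-a₀} = n^{3-a₀} / n³`
  have hneg : (n : ℝ) ^ (-a₀) = (n : ℝ) ^ (3 - a₀) / (n : ℝ) ^ 3 := by
    rw [show (-a₀) = (3 - a₀) - 3 by ring, Real.rpow_sub hn0]
    norm_num
  have hn3 : (0 : ℝ) < (n : ℝ) ^ 3 := by positivity
  have hlow : c / 54 * (n : ℝ) ^ (-a₀) ≤ criticalTwoPoint 3 (Pi.single 0 (m : ℤ)) := by
    rw [hneg, mul_div_assoc', div_le_iff₀ hn3]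
    linarith
  -- `n^{-a₀} ≥ ((K+1) m^e)^{-a₀} = (K+1)^{-a₀} m^{-2a₀/(3-a₀)}`
  have hanti : ((K + 1) * (m : ℝ) ^ e) ^ (-a₀) ≤ (n : ℝ) ^ (-a₀) :=
    Real.rpow_le_rpow_of_nonpos hn0 hnup (neg_nonpos.2 ha0)
  have hsplit : ((K + 1) * (m : ℝ) ^ e) ^ (-a₀) =
      (K + 1) ^ (-a₀) * (m : ℝ) ^ (-(2 * a₀ / (3 - a₀))) := by
    rw [Real.mul_rpow hK1.le (Real.rpow_nonneg hm0.le _), ← Real.rpow_mul hm0.le, he]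
    congr 2
    ring
  calc c / 54 * (K + 1) ^ (-a₀) * (m : ℝ) ^ (-(2 * a₀ / (3 - a₀)))
      = c / 54 * ((K + 1) ^ (-a₀) * (m : ℝ) ^ (-(2 * a₀ / (3 - a₀)))) := by ring
    _ = c / 54 * ((K + 1) * (m : ℝ) ^ e) ^ (-a₀) := by rw [hsplit]
    _ ≤ c / 54 * (n : ℝ) ^ (-a₀) := mul_le_mul_of_nonneg_left hanti (by positivity)
    _ ≤ criticalTwoPoint 3 (Pi.single 0 (m : ℤ)) := hlow

end Summit.CriticalPhenomena.Ising3DConformalLimit.SubPtolemyFloorSketch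

end
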